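import Summits.NavierStokesRegularity.NavierStokesRegularity.Theorems.SqueezeCycleSingularZoom
import Summits.NavierStokesRegularity.NavierStokesRegularity.Theorems.HubbleDynamoFarFieldSlavingTwoPointLocal
import Summits.NavierStokesRegularity.NavierStokesRegularity.Theorems.HubbleDynamoFarFieldSlavingTwoPointMarked
import Literature.Analysis.FluidPDE.Ferrari1993MoserInequality
import HarnessLib

/-!
# Crux `HubbleDynamo.FarFieldSlaving` (stmt-NavierStokesRegularity-1935): two final-time singular
# points from a violation of far-field slaving (the two-point zoom)

Helper file (theorems only) of the TWO-POINT REDUCTION of the crux (lead c3; main file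
`HubbleDynamoFarFieldSlavingTwoPoint.lean`). `hubbleDynamo_exists_twoPointModel`: let `(u, p)` be
classical on `[0, T)`, Leray–Hopf from a rapidly decaying datum, with the Type-I rate
(`IsTypeIBlowup u T`), and let `(T, x₀)` be a backward singular point at which the far-field
slaving bound `‖u t x‖ ≤ C / (‖x − x₀‖ + √(T − t))` fails on every `Q_δ(T, x₀)`. Zooming about
`(T, x₀)` (viscosity-normalising zooms of the tree's `singularZoom_zoomLimit`, Albritton–Barker
2019 §3 / KNSS 2009 §6) at the parabolic sizes `c_k ↓ 0` of violating points with `C = k`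
produces a Type-I KNSS-mild ancient field `ū ∈ 𝒦_C` (scaled energies `A, E ≤ C`) which is
unbounded near the space–time origin (persistence of the singularity at the centre) AND near a
second final-time point `(0, e)`, `‖e‖ = 1/4` (the limit position of the marked points, whose
values tend to `∞` and whose times therefore tend to `0⁻` by the rate; persistence with the limsup
hypothesis, `unbounded_at_origin_of_tendsto_top`, applied to the zoom-ins about the translated
centres `(0, c_k e)`, whose uniform `L³ × L^{3/2}` bounds come from the Type-I quantity of the unit
zoom on `Q(0, 1/2)`, `isSuitableWeakSolutionInBall_zoomInAt`).
-/

noncomputable section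

set_option linter.dupNamespace false

open MeasureTheory Set Function Filter TopologicalSpace Metric
open scoped Topology NNReal ENNReal InnerProductSpace RealInnerProductSpace

namespace Summit.NavierStokesRegularity.NavierStokesRegularity.Theorems

open Literature.Analysis Literature.Analysis.FluidPDE

section TwoPoint

/-- **Two singular points from a violation of far-field slaving (the zoom at the parabolic
distance of the violating points).** Let `(u, p)` be classical on `[0, T)`, Leray–Hopf from a
rapidly decaying datum, with the Type-I rate, let `(T, x₀)` be a backward singular point, and
suppose the far-field slaving bound fails at `x₀` at every radius: for all `δ > 0` and all `C`
some `(t, x) ∈ Q_δ(T, x₀)` has `‖u t x‖ > C / (‖x − x₀‖ + √(T − t))`. Then some Type-I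
KNSS-mild ancient field `ū ∈ 𝒦_C` (scaled energies `A, E ≤ C`) is unbounded near the
space–time origin AND near a second final-time point `(0, e)`, `e ≠ 0`. Proof: zoom about
`(T, x₀)` at the scales `c_k = 4(‖y_k‖ + √(−s_k)) ↓ 0` of violating points with `C = k`; the
marked points have zoomed parabolic size `1/4`, values `→ ∞`, hence (rate) times `→ 0⁻`; a
subsequence of their positions converges to `e`, `‖e‖ = 1/4`; the `C¹_loc` limit is singular at
the origin (persistence, as in `singularZoom_zoomLimit`) and unbounded near `(0, e)` (persistence
with the limsup hypothesis applied to the translated zoom-ins, whose uniform bounds come from the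
Type-I quantity of the unit zoom on `Q(0, 1/2)`). [cite: AlbrittonBarker2019, §3 and Prop. 2.3; KochNadirashviliSereginSverak2009, Lemma 6.1 and Thm 6.2 (arXiv pp. 11–13)] -/
theorem hubbleDynamo_exists_twoPointModel :
    ∀ (ν T : ℝ), 0 < ν → 0 < T →
      ∀ (u : ℝ → EuclideanSpace ℝ (Fin 3) → EuclideanSpace ℝ (Fin 3))
        (p : ℝ → EuclideanSpace ℝ (Fin 3) → ℝ),
        Literature.Analysis.FluidPDE.IsClassicalNSSolutionOn (Set.Ico 0 T) ν 0 u p →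
        Literature.Analysis.FluidPDE.IsLerayHopfOn T ν 0 (u 0) u →
        Literature.Analysis.FluidPDE.HasRapidSpatialDecay (u 0) →
        Literature.Analysis.FluidPDE.IsTypeIBlowup u T →
        ∀ x₀ : EuclideanSpace ℝ (Fin 3),
          (∀ r : ℝ, 0 < r → MeasureTheory.eLpNorm (Function.uncurry u) ⊤
            (MeasureTheory.volume.restrict
              (Literature.Analysis.FluidPDE.parabolicCylinder r ((T : ℝ), x₀))) = ⊤) →
          (∀ δ : ℝ, 0 < δ → ∀ C : ℝ, ∃ t ∈ Set.Ioo (T - δ ^ 2) T, ∃ x ∈ Metric.ball x₀ δ,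
            C / (‖x - x₀‖ + Real.sqrt (T - t)) < ‖u t x‖) →
          ∃ (C : ℝ) (ū : ℝ → EuclideanSpace ℝ (Fin 3) → EuclideanSpace ℝ (Fin 3))
            (e : EuclideanSpace ℝ (Fin 3)), e ≠ 0 ∧
            Literature.Analysis.FluidPDE.IsTypeIAncientMild C ū ∧
            (∀ (x₁ : EuclideanSpace ℝ (Fin 3)) (t₀ r : ℝ), t₀ ≤ 0 → 0 < r →
              (∀ t, t₀ - r ^ 2 < t → t < t₀ → r⁻¹ * ∫ x in Metric.ball x₁ r, ‖ū t x‖ ^ 2 ≤ C) ∧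
              r⁻¹ * ∫ t in Set.Ioo (t₀ - r ^ 2) t₀, ∫ x in Metric.ball x₁ r,
                ‖fderiv ℝ (ū t) x‖ ^ 2 ≤ C) ∧
            (∀ r > 0, ∀ M : ℝ, ∃ t ∈ Set.Ioo (-(r ^ 2)) (0 : ℝ),
              ∃ x ∈ Metric.ball (0 : EuclideanSpace ℝ (Fin 3)) r, M < ‖ū t x‖) ∧
            (∀ r > 0, ∀ M : ℝ, ∃ t ∈ Set.Ioo (-(r ^ 2)) (0 : ℝ),
              ∃ x ∈ Metric.ball e r, M < ‖ū t x‖) := by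
  intro ν T hν hT u p hsol hLH hdec hTI x₀ hsing hfail
  -- ## (1) the rate window, the Morrey bound and the unit zoom at `(T, x₀)`
  obtain ⟨C, δ, hC0, hδ, hδT, hrate⟩ := exists_typeI_rate_window hT hTI
  obtain ⟨r₀, M₀, T₁, hr₀, hT₁, hMor⟩ := morrey_of_typeI hν hT hsol hLH hTI
  obtain ⟨R, α, β, hR, hα, hβ, hβeq, hαeq, hβT, hball, hGv, htypeI⟩ :=
    exists_zoom_typeIBound_lt_top_of_morrey hν hT hsol hLH hr₀ hT₁ hMor x₀
  set v : ℝ → EuclideanSpace ℝ (Fin 3) → EuclideanSpace ℝ (Fin 3) := α • stPull β R T x₀ u with hv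
  set πv : ℝ → EuclideanSpace ℝ (Fin 3) → ℝ :=
    α ^ 2 • stPull β R T x₀ (fun t x => p t x - (p t 0 - normalisedPressure (u t) 0)) with hπv
  set Gv : ℝ → EuclideanSpace ℝ (Fin 3) → EuclideanSpace ℝ (Fin 3) →L[ℝ] EuclideanSpace ℝ (Fin 3) :=
    (α * R) • stPull β R T x₀ (fun t x => fderiv ℝ (u t) x) with hGvdef
  set I₀ : ℝ≥0∞ := typeIBound (parabolicCylinder (1 / 2) (0 : ℝ × EuclideanSpace ℝ (Fin 3))) v πv Gv
    with hI₀
  have hI₀top : I₀ ≠ ⊤ := htypeI.ne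
  set C₁ : ℝ := α * C / Real.sqrt β with hC₁
  have hsβ : 0 < Real.sqrt β := Real.sqrt_pos.2 hβ
  -- ## (2)–(3) marked scales and points (`hubbleDynamo_exists_markedScales`)
  obtain ⟨c, σ, η, hcpos, hc25, hclim, hσwin, hsize, hval_tendsto⟩ :=
    hubbleDynamo_exists_markedScales (T := T) (u := u) x₀ hR hα hβ hδ hfail
  have hc2 : ∀ k, c k ≤ 1 / 2 := fun k => (hc25 k).trans (by norm_num)
  -- the zooms and their final windows
  set w : ℕ → ℝ → EuclideanSpace ℝ (Fin 3) → EuclideanSpace ℝ (Fin 3) :=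
    fun k => (c k * α) • stPull (c k ^ 2 * β) (c k * R) T x₀ u with hw
  set A : ℕ → ℝ := fun k => -(δ / (c k ^ 2 * β)) with hA
  have hAlim : Tendsto A atTop atBot := by
    have h1 : Tendsto (fun k => c k ^ 2 * β) atTop (𝓝[>] 0) := by
      refine tendsto_nhdsWithin_iff.2 ⟨?_, Eventually.of_forall fun k =>
        mem_Ioi.2 (mul_pos (pow_pos (hcpos k) 2) hβ)⟩
      have h : Tendsto (fun k => c k ^ 2 * β) atTop (𝓝 (0 ^ 2 * β)) := (hclim.pow 2).mul_const β
      rwa [zero_pow two_ne_zero, zero_mul] at h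
    have h2 : Tendsto (fun k => δ / (c k ^ 2 * β)) atTop atTop :=
      Tendsto.const_mul_atTop hδ (tendsto_inv_nhdsGT_zero.comp h1) |>.congr fun k => by
        simp [div_eq_mul_inv]
    exact tendsto_neg_atTop_atBot.comp h2
  -- per-scale facts
  have hcW : ∀ k, ContinuousOn (uncurry (w k)) (Ioo (A k) 0 ×ˢ univ) := fun k =>
    zoom_continuousOn hν hsol hR hαeq hβeq (hcpos k) hδT
  have hdivW : ∀ k, ∀ t ∈ Ioo (A k) 0, IsWeaklyDivFree (w k t) := fun k t ht =>
    zoom_isWeaklyDivFree hν hsol hR hαeq hβeq (hcpos k) hδT ht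
  have hmildW : ∀ k, ∀ s t : ℝ, A k < s → s < t → t < 0 → ∀ y,
      w k t y = UnboundedOperators.heatExtension (w k s) (t - s) y -
        oseenDuhamel 1 s (w k) (w k) t y := fun k s t hs hst ht y =>
    zoom_oseen hν hT hsol hLH hdec hR hαeq hβeq (hcpos k) hδT hs hst ht y
  have hIW : ∀ k, ∀ t ∈ Ioo (A k) 0, ∀ y, ‖w k t y‖ ≤ C₁ / Real.sqrt (-t) := fun k t ht y =>
    zoom_norm_le hR hαeq hβeq hν (hcpos k) hδT hrate ht y
  have hσneg : ∀ k, σ k < 0 := fun k => (hσwin k).2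
  -- the rate forces the marked times to `0⁻`
  have hC₁0 : 0 ≤ C₁ := by rw [hC₁]; positivity
  have hsqσ_le : ∀ k, Real.sqrt (-(σ k)) * ‖w k (σ k) (η k)‖ ≤ C₁ := fun k => by
    have h := hIW k (σ k) (hσwin k) (η k)
    have hpos : 0 < Real.sqrt (-(σ k)) := Real.sqrt_pos.2 (neg_pos.2 (hσneg k))
    rw [le_div_iff₀ hpos] at h
    linarith [mul_comm (Real.sqrt (-(σ k))) ‖w k (σ k) (η k)‖]
  have hsqσ_lim : Tendsto (fun k => Real.sqrt (-(σ k))) atTop (𝓝 0) := by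
    -- `√(-σ_k) ≤ C₁ / ‖w_k(σ_k, η_k)‖ → 0`
    have h1 : Tendsto (fun k => C₁ / ‖w k (σ k) (η k)‖) atTop (𝓝 0) :=
      hval_tendsto.const_div_atTop C₁
    refine tendsto_of_tendsto_of_tendsto_of_le_of_le' tendsto_const_nhds h1
      (Eventually.of_forall fun k => Real.sqrt_nonneg _) ?_
    filter_upwards [hval_tendsto.eventually_gt_atTop 0] with k hk
    rw [le_div_iff₀ hk]
    exact hsqσ_le k
  have hη_norm : ∀ k, ‖η k‖ = 1 / 4 - Real.sqrt (-(σ k)) := fun k => by linarith [hsize k]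
  have hη_norm_lim : Tendsto (fun k => ‖η k‖) atTop (𝓝 (1 / 4)) := by
    have h : Tendsto (fun k => 1 / 4 - Real.sqrt (-(σ k))) atTop (𝓝 (1 / 4 - 0)) :=
      tendsto_const_nhds.sub hsqσ_lim
    rw [sub_zero] at h
    exact h.congr fun k => (hη_norm k).symm
  have hσ_lim : Tendsto σ atTop (𝓝 0) := by
    have h : Tendsto (fun k => -(Real.sqrt (-(σ k)) ^ 2)) atTop (𝓝 (-(0 ^ 2))) :=
      (hsqσ_lim.pow 2).neg
    rw [zero_pow two_ne_zero, neg_zero] at h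
    refine h.congr fun k => ?_
    rw [Real.sq_sqrt (neg_pos.2 (hσneg k)).le, neg_neg]
  have hη_mem : ∀ k, η k ∈ closedBall (0 : EuclideanSpace ℝ (Fin 3)) (1 / 4) := fun k => by
    rw [mem_closedBall_zero_iff, hη_norm k]
    linarith [Real.sqrt_nonneg (-(σ k))]
  -- ## (4) a subsequence along which the marked positions converge, `η → e`, `‖e‖ = 1/4`
  obtain ⟨e, -, ψ, hψ, hηe⟩ := (isCompact_closedBall (0 : EuclideanSpace ℝ (Fin 3)) (1 / 4)).tendsto_subseq hη_mem
  have hψt : Tendsto ψ atTop atTop := hψ.tendsto_atTop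
  have he_norm : ‖e‖ = 1 / 4 :=
    tendsto_nhds_unique ((continuous_norm.tendsto e).comp hηe) (hη_norm_lim.comp hψt)
  have he0 : e ≠ 0 := by
    intro h; rw [h, norm_zero] at he_norm; norm_num at he_norm
  -- ## (5) extraction of the `C¹_loc` limit along `ψ`
  obtain ⟨φ, hφ, W, hWclass, hpt, hptG, -, -⟩ :=
    exists_tendsto_of_typeI_seq_Ioo C₁ (hAlim.comp hψt) (w := fun k => w (ψ k))
      (fun k => hcW (ψ k)) (fun k => hdivW (ψ k)) (fun k => hmildW (ψ k)) (fun k => hIW (ψ k))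
  set ι : ℕ → ℕ := fun j => ψ (φ j) with hι
  have hιt : Tendsto ι atTop atTop := hψt.comp hφ.tendsto_atTop
  have hcι : Tendsto (fun j => c (ι j)) atTop (𝓝 0) := hclim.comp hιt
  have hAι : Tendsto (fun j => A (ι j)) atTop atBot := hAlim.comp hιt
  -- ## (6) the scale-invariant energies of `W`
  set B : ℝ := max (α ^ 2 * M₀ / R ^ 2) I₀.toReal with hB
  have hB0 : 0 ≤ B := le_max_of_le_right ENNReal.toReal_nonneg
  have henA : ∀ (x₁ : EuclideanSpace ℝ (Fin 3)) (t : ℝ), t < 0 → ∀ r : ℝ, 0 < r →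
      ∀ᶠ j in atTop, r⁻¹ * ∫ y in ball x₁ r, ‖w (ι j) t y‖ ^ 2 ≤ B := by
    intro x₁ t ht r hr
    have e1 : ∀ᶠ j in atTop, c (ι j) * R * r < r₀ := by
      have h : Tendsto (fun j => c (ι j) * R * r) atTop (𝓝 (0 * R * r)) :=
        (hcι.mul_const R).mul_const r
      rw [zero_mul, zero_mul] at h
      exact h.eventually_lt_const hr₀
    have e2 : ∀ᶠ j in atTop, T₁ < T + c (ι j) ^ 2 * β * t := by
      have h : Tendsto (fun j => T + c (ι j) ^ 2 * β * t) atTop (𝓝 (T + 0 ^ 2 * β * t)) :=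
        (((hcι.pow 2).mul_const β).mul_const t).const_add T
      rw [zero_pow two_ne_zero, zero_mul, zero_mul, add_zero] at h
      exact h.eventually_const_lt hT₁
    filter_upwards [e1, e2] with j hj1 hj2
    have hpos : 0 < c (ι j) ^ 2 * β := mul_pos (pow_pos (hcpos (ι j)) 2) hβ
    have hlt : T + c (ι j) ^ 2 * β * t < T := by
      calc T + c (ι j) ^ 2 * β * t < T + 0 := (add_lt_add_iff_left T).2 (mul_neg_of_pos_of_neg hpos ht)
        _ = T := add_zero T
    exact (zoom_scaledEnergy_le hR (hcpos (ι j)) hMor ⟨hj2, hlt⟩ x₁ hr hj1.le).trans (le_max_left _ _)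
  have henE : ∀ (x₁ : EuclideanSpace ℝ (Fin 3)) (t₀ r : ℝ), t₀ < 0 → 0 < r →
      ∀ᶠ j in atTop,
        r⁻¹ * ∫ t in Ioo (t₀ - r ^ 2) t₀, ∫ y in ball x₁ r, ‖fderiv ℝ (w (ι j) t) y‖ ^ 2 ≤ B := by
    intro x₁ t₀ r ht₀ hr
    have e1 : ∀ᶠ j in atTop, A (ι j) < t₀ - r ^ 2 - 1 := hAι.eventually (eventually_lt_atBot _)
    have e2 : ∀ᶠ j in atTop, c (ι j) ^ 2 * (r ^ 2 - t₀) < 1 / 4 := by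
      have h : Tendsto (fun j => c (ι j) ^ 2 * (r ^ 2 - t₀)) atTop (𝓝 (0 ^ 2 * (r ^ 2 - t₀))) :=
        (hcι.pow 2).mul_const _
      rw [zero_pow two_ne_zero, zero_mul] at h
      exact h.eventually_lt_const (by norm_num)
    have e3 : ∀ᶠ j in atTop, c (ι j) * (‖x₁‖ + r) < 1 / 2 := by
      have h : Tendsto (fun j => c (ι j) * (‖x₁‖ + r)) atTop (𝓝 (0 * (‖x₁‖ + r))) :=
        hcι.mul_const _
      rw [zero_mul] at h
      exact h.eventually_lt_const (by norm_num)
    filter_upwards [e1, e2, e3] with j hj1 hj2 hj3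
    exact (zoom_gradEnergy_le (x₀ := x₀) (πv := πv) hν hsol hR hαeq hβeq (hcpos (ι j)) hδT hI₀top
      ht₀ hr (hj1.trans (sub_one_lt _)) hj2.le hj3.le).trans (le_max_right _ _)
  have hen := energyBounds_of_tendsto_Ioo C₁ hB0 hAι (w := fun j => w (ι j))
    (fun j => hcW (ι j)) (fun j => hdivW (ι j)) (fun j => hmildW (ι j)) (fun j => hIW (ι j))
    henA henE hWclass hpt hptG
  -- ## (7) `W` is unbounded at the origin (persistence at the singular centre)
  have hsingW : ∀ r > 0, ∀ M : ℝ, ∃ t ∈ Ioo (-(r ^ 2)) (0 : ℝ),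
      ∃ x ∈ ball (0 : EuclideanSpace ℝ (Fin 3)) r, M < ‖W t x‖ :=
    zoomSeq_unbounded_at_origin (πv := πv) hsol hR hα hβ hβT hsing hball hGv hI₀top
      (c := fun j => c (ι j)) (fun j => hcpos (ι j)) (fun j => hc2 (ι j)) fun z hz =>
        hpt z.1 ((SuitableCompactness.mem_parabolicCylinder_zero.1 hz).1.2) z.2
  -- ## (8) `W` is unbounded near `(0, e)`: persistence for the translated zoom-ins
  set W' : ℕ → ℝ → EuclideanSpace ℝ (Fin 3) → EuclideanSpace ℝ (Fin 3) :=
    fun j => c (ι j) • stPull (c (ι j) ^ 2) (c (ι j)) 0 (c (ι j) • e) v with hW'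
  set P' : ℕ → ℝ → EuclideanSpace ℝ (Fin 3) → ℝ := fun j => fun t x =>
    (c (ι j) ^ 2 • stPull (c (ι j) ^ 2) (c (ι j)) 0 (c (ι j) • e) πv) t x -
      ⨍ y in ball (0 : EuclideanSpace ℝ (Fin 3)) 1,
        (c (ι j) ^ 2 • stPull (c (ι j) ^ 2) (c (ι j)) 0 (c (ι j) • e) πv) t y with hP'
  -- the translated image balls lie in `Q(0, 1/2)` (`c ≤ 2/5`, `‖e‖ = 1/4`)
  have hsub : ∀ k, parabolicCylinder (c k) (((0 : ℝ), c k • e) : ℝ × EuclideanSpace ℝ (Fin 3)) ⊆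
      parabolicCylinder (1 / 2) (0 : ℝ × EuclideanSpace ℝ (Fin 3)) := fun k =>
    parabolicCylinder_smul_subset_half (hcpos k) (hc25 k) he_norm
  have hW'eq : ∀ j t x, W' j t x = w (ι j) t (x + e) := fun j t x => by
    simp only [hW', hw, hv]
    exact zoomInAt_smul_eq T x₀ e u α β R (c (ι j)) t x
  have hInBall' : ∀ j, IsSuitableWeakSolutionInBall 1 0 (W' j) (P' j) := fun j =>
    isSuitableWeakSolutionInBall_zoomInAt hball hGv hI₀top (hcpos (ι j)) (hsub (ι j))
  have hbound' : (⨆ j, eLpNorm (uncurry (W' j)) 3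
        (volume.restrict (parabolicCylinder 1 (0 : ℝ × EuclideanSpace ℝ (Fin 3)))) +
      eLpNorm (uncurry (P' j)) (3 / 2)
        (volume.restrict (parabolicCylinder 1 (0 : ℝ × EuclideanSpace ℝ (Fin 3))))) < ∞ := by
    refine lt_of_le_of_lt (iSup_le fun j => add_le_add
      (eLpNorm_zoomInAt_velocity_le (hcpos (ι j)) (hsub (ι j)) πv Gv)
      (eLpNorm_zoomInAt_pressure_le (hcpos (ι j)) (hsub (ι j)) v Gv)) ?_
    exact ENNReal.add_lt_top.2 ⟨ENNReal.rpow_lt_top_of_nonneg (by norm_num) hI₀top,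
      ENNReal.rpow_lt_top_of_nonneg (by norm_num) hI₀top⟩
  -- the marked points drive `‖W'_j‖_{L^∞(Q(0, R'))} → ∞`
  have hmarkσ : Tendsto (fun j => σ (ι j)) atTop (𝓝 0) := hσ_lim.comp hιt
  have hmarkη : Tendsto (fun j => η (ι j) - e) atTop (𝓝 0) := by
    have h : Tendsto (fun j => η (ι j)) atTop (𝓝 e) := hηe.comp hφ.tendsto_atTop
    have h2 := h.sub_const e
    rwa [sub_self] at h2
  have hsing' : ∀ R' ∈ Ioo (0 : ℝ) 1, Tendsto (fun j => eLpNorm (uncurry (W' j)) ∞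
      (volume.restrict (parabolicCylinder R' (0 : ℝ × EuclideanSpace ℝ (Fin 3))))) atTop (𝓝 ∞) := by
    intro R' hR'
    -- eventually the marked point `(σ, η - e)` lies in `Q(0, R')`
    have e1 : ∀ᶠ j in atTop, -R' ^ 2 < σ (ι j) :=
      hmarkσ.eventually_const_lt (neg_neg_of_pos (pow_pos hR'.1 2) : -R' ^ 2 < (0 : ℝ))
    have e2 : ∀ᶠ j in atTop, ‖η (ι j) - e‖ < R' := by
      have h := (continuous_norm.tendsto (0 : EuclideanSpace ℝ (Fin 3))).comp hmarkη
      rw [norm_zero] at h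
      exact h.eventually_lt_const hR'.1
    have hval' : Tendsto (fun j => (‖w (ι j) (σ (ι j)) (η (ι j))‖ₑ : ℝ≥0∞)) atTop (𝓝 ∞) := by
      have h := ENNReal.tendsto_ofReal_atTop.comp (hval_tendsto.comp hιt)
      refine h.congr fun j => ?_
      simp only [Function.comp_apply, ofReal_norm, hw]
    have e0 : ∀ᶠ j in atTop, A (ι j) < -1 := hAι.eventually (eventually_lt_atBot _)
    refine tendsto_nhds_top_mono hval' ?_
    filter_upwards [e0, e1, e2] with j hj0 hj1 hj2
    -- `W'_j` is continuous on the open ball `Q(0, R')`, which contains the marked point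
    have hmem : ((σ (ι j), η (ι j) - e) : ℝ × EuclideanSpace ℝ (Fin 3)) ∈
        parabolicCylinder R' (0 : ℝ × EuclideanSpace ℝ (Fin 3)) := by
      rw [SuitableCompactness.mem_parabolicCylinder_zero]
      exact ⟨⟨hj1, hσneg (ι j)⟩, hj2⟩
    have hsubQ : parabolicCylinder R' (0 : ℝ × EuclideanSpace ℝ (Fin 3)) ⊆
        Ioo (A (ι j)) 0 ×ˢ (univ : Set (EuclideanSpace ℝ (Fin 3))) := by
      intro z hz
      rw [SuitableCompactness.mem_parabolicCylinder_zero] at hz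
      refine ⟨⟨?_, hz.1.2⟩, mem_univ _⟩
      have hR1 : R' ^ 2 < 1 := pow_lt_one₀ hR'.1.le hR'.2 two_ne_zero
      exact (hj0.trans (neg_lt_neg hR1)).trans hz.1.1
    have hcont : ContinuousOn (uncurry (W' j)) (parabolicCylinder R' (0 : ℝ × EuclideanSpace ℝ (Fin 3))) := by
      have h1 : ContinuousOn (uncurry (w (ι j))) (Ioo (A (ι j)) 0 ×ˢ univ) := hcW (ι j)
      have h2 : ContinuousOn (fun z : ℝ × EuclideanSpace ℝ (Fin 3) => uncurry (w (ι j)) (z.1, z.2 + e))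
          (parabolicCylinder R' (0 : ℝ × EuclideanSpace ℝ (Fin 3))) := by
        refine h1.comp (by fun_prop) fun z hz => ?_
        obtain ⟨hz1, -⟩ := hsubQ hz
        exact ⟨hz1, mem_univ _⟩
      refine h2.congr fun z _ => ?_
      simp only [uncurry, hW'eq]
    have hle := enorm_le_eLpNorm_top_of_continuousOn_isOpen (μ := (volume : Measure (ℝ × EuclideanSpace ℝ (Fin 3))))
      (isOpen_parabolicCylinder R' (0 : ℝ × EuclideanSpace ℝ (Fin 3))) hcont hmem
    simp only [uncurry, hW'eq, sub_add_cancel] at hle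
    exact hle
  have hpt' : ∀ z ∈ parabolicCylinder (1 / 2) (0 : ℝ × EuclideanSpace ℝ (Fin 3)),
      Tendsto (fun j => W' j z.1 z.2) atTop (𝓝 (W z.1 (z.2 + e))) := by
    intro z hz
    have ht : z.1 < 0 := ((SuitableCompactness.mem_parabolicCylinder_zero.1 hz).1).2
    exact (hpt z.1 ht (z.2 + e)).congr fun j => (hW'eq j z.1 z.2).symm
  have hsingE' := unbounded_at_origin_of_tendsto_top hInBall' hbound' hsing'
    (Wlim := fun t x => W t (x + e)) hpt'
  have hsingE : ∀ r > 0, ∀ M : ℝ, ∃ t ∈ Ioo (-(r ^ 2)) (0 : ℝ), ∃ x ∈ ball e r, M < ‖W t x‖ := by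
    intro r hr M
    obtain ⟨t, ht, x, hx, hM⟩ := hsingE' r hr M
    refine ⟨t, ht, x + e, ?_, hM⟩
    rwa [mem_ball, dist_eq_norm, add_sub_cancel_right, ← mem_ball_zero_iff]
  -- ## (9) conclusion: one constant for the rate and the energies
  refine ⟨max C₁ B, W, e, he0, ?_, ?_, hsingW, hsingE⟩
  · exact ⟨hWclass.1, hWclass.2.1, hWclass.2.2.1, fun t ht x =>
      (hWclass.norm_le ht x).trans
        (div_le_div_of_nonneg_right (le_max_left _ _) (Real.sqrt_nonneg _))⟩
  · intro x₁ t₀ r ht₀ hr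
    obtain ⟨h1, h2⟩ := hen x₁ t₀ r ht₀ hr
    exact ⟨fun t ht1 ht2 => (h1 t ht1 ht2).trans (le_max_right _ _), h2.trans (le_max_right _ _)⟩


end TwoPoint

end Summit.NavierStokesRegularity.NavierStokesRegularity.Theorems

end
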